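import Summits.HodgeConjecture.HodgeConjecture.Theorems.R90S6BCPartnerPairRecursion  -- FILE A (R1)(R2) (brings ★ W10-c (B.1′), ★ W10-g (H.4))
import Summits.HodgeConjecture.HodgeConjecture.Theorems.R90S6MacdonaldRankOne         -- ★ W8-g: `doubleCosetOperator_torusGen_mul_pow∕_mul_self`, `torusGen_eq_basic`
import HarnessLib

/-!
# R90 · S6 «Ch. 14.1–14.5 stable TF» — card W10-h (h.1′), FILE B: THE SHELL ∕ TOP-COEFFICIENT THEOREM FOR `b = ψ̂_G` ON THE `U(3)` CARTAN BASIS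
# (`Theorems/R90S6BCPartnerShell.lean`; row E1.4.4.2.3 «`bφ_λ = Σ_m c_{λ,m} φ_m`»)

Cell `hodgecm-mathlib`, crux H413 (`stmt-HodgeConjecture-24833`), route of record `HCCMUnconditional`; programme R90-TF, section S6 (base `R90-C14`),
seat K2Liu-p27 (g4) (cross-line hand, chair K2-lead VALVE 14, 2026-09-05T01:49:33Z); S6 dealer R90-C14-plan (g2) RE-SCOPE of card W10-h (R90 bus
01:48:30Z, GO 01:54:52Z): «(i) SHELL∕TOP-COEFFICIENT THEOREM `b(c_{(a,b,0)}) ∈ Φ_a + span_ℂ{Φ_k : k < a}` by induction on `a` over ★ (H.3) + ★ W10-c +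
★ U(3) three-term law, (ii) `bT₃ = 1` central reduction (★), (iii) the recursion restated as the public API with the β-table rows (1,0)…(2,2) as named corollaries».
Lane `--supports stmt-HodgeConjecture-24833 --as helper`; THEOREMS ONLY (no definition, no instance, no notation, no named fact, no `sorry`).
This is FILE B of three (A `R90S6BCPartnerPairRecursion`: the recursion (R1)(R2); C `R90S6BCPartnerShellRows`: the rows of the β-table).

LETTERS (`GL₃` side, VERBATIM as ★ W10-c∕W10-g): generic DVR field `K` (`hϖ`, `hu : u² = q`, `hwt`), `q = #𝓀[K]`, `c_ν := 1_{K₀ ϖ^ν K₀} =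
doubleCosetOperator (glInt 3 K) (zpowDiagGL ν)`, `T₁ = 1_{K₀ diag(ϖ,1,1) K₀}`, `b := bcGraphPartnerAlgHom …` (print's `ψ̂_G`), `B_ν := b(c_ν)`, and the two-parameter
family `B_{a,b} := B_{(a,b,0)}`, written `![(a : ℤ), (b : ℤ), 0]` with `a b : ℕ` (`B_ν` only depends on `ν` mod `𝟙`, ★ (H.4.c)).
`U(3)` side as ★ (B.1′): any unramified datum `hd : UnramifiedLocalConjDatum σ_w ϖ'` at the inert place `w`, `t = hd.torusGen = diag(ϖ',1,ϖ'⁻¹)`,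
`Φ_m := 1_{K₀ tᵐ K₀} = doubleCosetOperator (unitaryInt σ_w J₀) (hd.torusGen ^ m)`, `Q = #𝓀[E_w]`, `√Q = Nat.sqrt Q` (`√Q·√Q = Q`, ★ `sqrt_card_residueField_mul_self`),
and the junction identity `hqQ : (#𝓀[K] : ℂ) = Q` (discharged at `K = E_w` by ★ `natCard_residueField_eq_of_compatible`).

WHAT IS PROVED.
* §1 a light-carrier ENGINE (private; opaque letters `Φ : ℕ → H` in any `ℂ`-algebra `[Semiring H]` with `Φ₀ = 1`, an abstract square law, an abstract three-term
  law and `Φ_m Φ₁ = Φ₁ Φ_m`): «`x ∈ Φ_n + span{Φ_k : k < n}`, `x·T = y + z₁ + z₂`, `T = Φ₁ + c·1`, `z_i ∈ span{Φ_k : k ≤ n}` ⟹ `y ∈ Φ_{n+1} + span{Φ_k : k ≤ n}`».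
* §2 **`exists_bcGraphPartnerAlgHom_cartan_pair_eq_add_sum`** (h.1′): for `b ≤ a`, `B_{a,b} = Φ_a + Σ_{k<a} β_k • Φ_k` — TOP COEFFICIENT ONE on the shell of radius `a`
  (strong induction on `a` over FILE A's (R1)∕(R2), ★ (B.1′) `bT₁ = Φ₁ + (Q − √Q + 1)•1`, ★ W8-g, ★ Gelfand commutativity `isGelfandPair_unitaryInt`);
  **`exists_bcGraphPartnerAlgHom_cartan_eq_add_sum_of_antitone`** (mod centre): for every antitone `ν`, `b(c_ν) = Φ_{ν₀−ν₂} + Σ_{k<ν₀−ν₂} β_k • Φ_k`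
  (★ (H.4.c) `bT₃ = 1` iterated over `ℤ`).
ENGINEERING NOTE (for the next hand on these carriers).  Inside `ℋ(U(3)_w, K₀)`-valued hypotheses every rewrite is a `simp only` (reducible matching):
`rw … at h`, `congr`, `subst` compare the Pieri-strip `Antitone` conditions or the `SetLike` instance chains at default transparency and time out (cf. ★ W10-c);
the carrier has no usable `−` (its `Sub` is `AddSubgroupClass.sub`), so everything is stated additively.  The engine is over `[Semiring H]` (not `[Ring H]`): the carrier's `*` elaborates through `Subalgebra.toSemiring`, so the
structure argument is assigned by first-order unification at the instantiation.
HONEST LABEL: local Hecke bookkeeping for E1.4.4.2.3, count-neutral until the BC identity consumes it; HC_CM is proved only modulo the 7 printed citations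
(2 remaining named inputs: hLiu418 = stmt-HodgeConjecture-24832, h413 = stmt-HodgeConjecture-24833) until rung 0 closes; REL ≠ ★ ≠ BUILT.

## References
* [Rogawski1990] J. D. Rogawski, *Automorphic Representations of Unitary Groups in Three Variables*, Ann. of Math. Stud. 123 (1990), §4.10 Prop. 4.10.2 p. 58.
* [Macdonald1995] I. G. Macdonald, *Symmetric Functions and Hall Polynomials*, 2nd ed. (1995), Ch. II (4.6), Ch. V (2.5)–(2.6).
* [Macdonald1971] I. G. Macdonald, *Spherical functions on a group of p-adic type* (1971), Ch. V §3.
* [CartierCorvallis1979] P. Cartier, *Representations of 𝔭-adic groups: a survey*, PSPM 33.1 (1979), §IV (4.2), Thm. 4.1, Cor. 4.2.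
-/

set_option autoImplicit false
-- the mandated namespace repeats the single-problem summit's segment (`HodgeConjecture.HodgeConjecture`)
set_option linter.dupNamespace false

noncomputable section

open MulAction
open NumberField IsDedekindDomain
open Literature.NumberTheory.Automorphic Literature.NumberTheory.Automorphic.HermitianLattice Literature.NumberTheory.Automorphic.UnitaryGroup
open Literature.NumberTheory.Automorphic.CartanUnique
open scoped MatrixGroups
open ValuativeRel

namespace Summit.HodgeConjecture.HodgeConjecture.R90.S6

universe u

/-! ## §1 The light-carrier engine: `span{Φ_k : k < n}` and `Φ_n + span{Φ_k : k < n}` under an abstract three-term law -/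

section Engine

variable {H : Type*} [Semiring H] [Algebra ℂ H] (Φ : ℕ → H)

/-- `0 ∈ span{Φ_k : k < n}`. [folklore] -/
private theorem low_zero (n : ℕ) : ∃ γ : ℕ → ℂ, (0 : H) = ∑ k ∈ Finset.range n, γ k • Φ k :=
  ⟨fun _ => 0, by simp⟩

/-- `span{Φ_k : k < n}` is closed under addition. [folklore] -/
private theorem low_add {n : ℕ} {z₁ z₂ : H} (h₁ : ∃ γ : ℕ → ℂ, z₁ = ∑ k ∈ Finset.range n, γ k • Φ k)
    (h₂ : ∃ γ : ℕ → ℂ, z₂ = ∑ k ∈ Finset.range n, γ k • Φ k) :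
    ∃ γ : ℕ → ℂ, z₁ + z₂ = ∑ k ∈ Finset.range n, γ k • Φ k := by
  obtain ⟨γ₁, rfl⟩ := h₁
  obtain ⟨γ₂, rfl⟩ := h₂
  exact ⟨fun k => γ₁ k + γ₂ k, by rw [← Finset.sum_add_distrib]; exact Finset.sum_congr rfl fun k _ => (add_smul _ _ _).symm⟩

/-- `span{Φ_k : k < n}` is closed under scalars. [folklore] -/
private theorem low_smul {n : ℕ} {z : H} (c : ℂ) (h : ∃ γ : ℕ → ℂ, z = ∑ k ∈ Finset.range n, γ k • Φ k) :
    ∃ γ : ℕ → ℂ, c • z = ∑ k ∈ Finset.range n, γ k • Φ k := by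
  obtain ⟨γ, rfl⟩ := h
  exact ⟨fun k => c * γ k, by rw [Finset.smul_sum]; exact Finset.sum_congr rfl fun k _ => smul_smul _ _ _⟩

/-- `span{Φ_k : k < m} ⊆ span{Φ_k : k < n}` for `m ≤ n`. [folklore] -/
private theorem low_mono {m n : ℕ} (hmn : m ≤ n) {z : H} (h : ∃ γ : ℕ → ℂ, z = ∑ k ∈ Finset.range m, γ k • Φ k) :
    ∃ γ : ℕ → ℂ, z = ∑ k ∈ Finset.range n, γ k • Φ k := by
  obtain ⟨γ, rfl⟩ := h
  refine ⟨fun k => if k < m then γ k else 0, ?_⟩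
  beta_reduce
  rw [← Finset.sum_range_add_sum_Ico _ hmn, Finset.sum_eq_zero (s := Finset.Ico m n) (fun k hk => by
    rw [if_neg (not_lt.2 (Finset.mem_Ico.1 hk).1), zero_smul]), add_zero]
  exact Finset.sum_congr rfl fun k hk => by rw [if_pos (Finset.mem_range.1 hk)]

/-- `Φ_n + span{Φ_k : k < n} ⊆ span{Φ_k : k ≤ n}`. [folklore] -/
private theorem low_of_shell {n : ℕ} {x : H} (h : ∃ β : ℕ → ℂ, x = Φ n + ∑ k ∈ Finset.range n, β k • Φ k) :
    ∃ γ : ℕ → ℂ, x = ∑ k ∈ Finset.range (n + 1), γ k • Φ k := by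
  obtain ⟨β, rfl⟩ := h
  refine ⟨fun k => if k < n then β k else 1, ?_⟩
  beta_reduce
  rw [Finset.sum_range_succ, if_neg (lt_irrefl n), one_smul, add_comm (Φ n)]
  congr 1
  exact Finset.sum_congr rfl fun k hk => by rw [if_pos (Finset.mem_range.1 hk)]

/-- `(Φ_n + span_{<n}) + span_{<n} ⊆ Φ_n + span_{<n}`. [folklore] -/
private theorem shell_add_low {n : ℕ} {x z : H} (hx : ∃ β : ℕ → ℂ, x = Φ n + ∑ k ∈ Finset.range n, β k • Φ k)
    (hz : ∃ γ : ℕ → ℂ, z = ∑ k ∈ Finset.range n, γ k • Φ k) :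
    ∃ β : ℕ → ℂ, x + z = Φ n + ∑ k ∈ Finset.range n, β k • Φ k := by
  obtain ⟨β, rfl⟩ := hx
  obtain ⟨γ, hγ⟩ := low_add Φ ⟨β, rfl⟩ hz
  exact ⟨γ, by rw [add_assoc, hγ]⟩

/-- `(if p then N else 0) • x ∈ span_{<n}` as soon as `x ∈ span_{<n}` whenever `p` holds (the absent Pieri strips carry coefficient `0`). [folklore] -/
private theorem low_ite_smul {p : Prop} [Decidable p] (N : ℂ) {n : ℕ} {x : H}
    (hx : p → ∃ γ : ℕ → ℂ, x = ∑ k ∈ Finset.range n, γ k • Φ k) :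
    ∃ γ : ℕ → ℂ, (if p then N else 0) • x = ∑ k ∈ Finset.range n, γ k • Φ k := by
  by_cases hp : p
  · rw [if_pos hp]; exact low_smul Φ N (hx hp)
  · rw [if_neg hp, zero_smul]; exact low_zero Φ n

variable {s t r : ℂ} (h0 : Φ 0 = 1) (hsq : Φ 1 * Φ 1 = Φ 2 + s • Φ 1 + t • 1)
  (hrec : ∀ m : ℕ, 2 ≤ m → Φ 1 * Φ m = Φ (m + 1) + s • Φ m + r • Φ (m - 1)) (hcomm : ∀ m : ℕ, Φ m * Φ 1 = Φ 1 * Φ m)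

include h0 hsq hrec hcomm

/-- **`Φ_n · Φ₁ ∈ Φ_{n+1} + span{Φ_k : k ≤ n}`** — the abstract three-term law (`n ≥ 2`), the square law (`n = 1`) and `Φ₀ = 1` (`n = 0`). [cite: Macdonald1971, Ch. V §3] -/
private theorem shell_gen_mul_gen (n : ℕ) : ∃ β : ℕ → ℂ, Φ n * Φ 1 = Φ (n + 1) + ∑ k ∈ Finset.range (n + 1), β k • Φ k := by
  rcases n with _ | n
  · exact ⟨fun _ => 0, by simp [h0]⟩
  rcases n with _ | n
  · refine ⟨fun k => if k = 0 then t else s, ?_⟩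
    beta_reduce
    rw [hsq, Finset.sum_range_succ, Finset.sum_range_one, if_pos rfl, if_neg one_ne_zero, h0]
    abel
  · refine ⟨fun k => if k = n + 2 then s else if k = n + 1 then r else 0, ?_⟩
    beta_reduce
    rw [hcomm, hrec (n + 2) (by omega), Finset.sum_range_succ, Finset.sum_range_succ, if_pos rfl, if_neg (by omega), if_pos rfl,
      show n + 2 - 1 = n + 1 from rfl, Finset.sum_eq_zero (fun k hk => by
        rw [if_neg (by have := Finset.mem_range.1 hk; omega), if_neg (by have := Finset.mem_range.1 hk; omega), zero_smul]), zero_add]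
    abel

/-- `span{Φ_k : k < n} · Φ₁ ⊆ span{Φ_k : k ≤ n}`. [cite: Macdonald1971, Ch. V §3] -/
private theorem low_mul_gen {n : ℕ} {z : H} (h : ∃ γ : ℕ → ℂ, z = ∑ k ∈ Finset.range n, γ k • Φ k) :
    ∃ γ : ℕ → ℂ, z * Φ 1 = ∑ k ∈ Finset.range (n + 1), γ k • Φ k := by
  obtain ⟨γ, rfl⟩ := h
  induction n with
  | zero => exact ⟨fun _ => 0, by simp⟩
  | succ n ih =>
    rw [Finset.sum_range_succ, add_mul, smul_mul_assoc]
    exact low_add Φ (low_mono Φ (Nat.le_succ _) ih) (low_smul Φ (γ n) (low_of_shell Φ (shell_gen_mul_gen Φ h0 hsq hrec hcomm n)))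

/-- `(Φ_n + span_{<n}) · Φ₁ ⊆ Φ_{n+1} + span_{≤ n}`. [cite: Macdonald1971, Ch. V §3] -/
private theorem shell_mul_gen {n : ℕ} {x : H} (h : ∃ β : ℕ → ℂ, x = Φ n + ∑ k ∈ Finset.range n, β k • Φ k) :
    ∃ β : ℕ → ℂ, x * Φ 1 = Φ (n + 1) + ∑ k ∈ Finset.range (n + 1), β k • Φ k := by
  obtain ⟨β, rfl⟩ := h
  rw [add_mul]
  exact shell_add_low Φ (shell_gen_mul_gen Φ h0 hsq hrec hcomm n) (low_mul_gen Φ h0 hsq hrec hcomm ⟨β, rfl⟩)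

/-- **THE ENGINE STEP.**  If `x ∈ Φ_n + span_{<n}`, `x · T = y + z` with `T = Φ₁ + c • 1` and `z ∈ span_{≤ n}`, then `y ∈ Φ_{n+1} + span_{≤ n}` — the shape of the
solved `b`-recursion (`x = B_{a,b}`, `T = bT₁`, `y = B_{a+1,b}`, `z` = the lower Pieri terms). [cite: Macdonald1971, Ch. V §3] [cite: Macdonald1995, Ch. V (2.6)] -/
private theorem shell_of_step [IsRightCancelAdd H] {n : ℕ} {x y z T : H} {c : ℂ} (hT : T = Φ 1 + c • 1) (hxy : x * T = y + z)
    (hx : ∃ β : ℕ → ℂ, x = Φ n + ∑ k ∈ Finset.range n, β k • Φ k) (hz : ∃ γ : ℕ → ℂ, z = ∑ k ∈ Finset.range (n + 1), γ k • Φ k) :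
    ∃ β : ℕ → ℂ, y = Φ (n + 1) + ∑ k ∈ Finset.range (n + 1), β k • Φ k := by
  -- (no subtraction in `H`: cancel `z` on the right instead)
  obtain ⟨β', h'⟩ := shell_add_low Φ (shell_mul_gen Φ h0 hsq hrec hcomm hx) (low_smul Φ c (low_of_shell Φ hx))
  obtain ⟨γ, hγ⟩ := hz
  refine ⟨fun k => β' k - γ k, add_right_cancel (b := z) ?_⟩
  rw [← hxy, hT, mul_add, mul_smul_comm, mul_one, h', hγ, add_assoc, ← Finset.sum_add_distrib]
  congr 1
  exact Finset.sum_congr rfl fun k _ => by rw [← add_smul, sub_add_cancel]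

/-- The engine step with two lower terms (`x · T = y + z₁ + z₂`), the shape of the two-parameter recursion (R1). [cite: Macdonald1971, Ch. V §3] -/
private theorem shell_of_step₂ [IsRightCancelAdd H] {n : ℕ} {x y z₁ z₂ T : H} {c : ℂ} (hT : T = Φ 1 + c • 1) (hxy : x * T = y + z₁ + z₂)
    (hx : ∃ β : ℕ → ℂ, x = Φ n + ∑ k ∈ Finset.range n, β k • Φ k) (hz₁ : ∃ γ : ℕ → ℂ, z₁ = ∑ k ∈ Finset.range (n + 1), γ k • Φ k)
    (hz₂ : ∃ γ : ℕ → ℂ, z₂ = ∑ k ∈ Finset.range (n + 1), γ k • Φ k) :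
    ∃ β : ℕ → ℂ, y = Φ (n + 1) + ∑ k ∈ Finset.range (n + 1), β k • Φ k :=
  shell_of_step Φ h0 hsq hrec hcomm hT (hxy.trans (add_assoc y z₁ z₂)) hx (low_add Φ hz₁ hz₂)

/-- The engine step with the lower terms written first (`x · T = z + y`), the shape of the diagonal recursion. [cite: Macdonald1971, Ch. V §3] -/
private theorem shell_of_step' [IsRightCancelAdd H] {n : ℕ} {x y z T : H} {c : ℂ} (hT : T = Φ 1 + c • 1) (hxy : x * T = z + y)
    (hx : ∃ β : ℕ → ℂ, x = Φ n + ∑ k ∈ Finset.range n, β k • Φ k) (hz : ∃ γ : ℕ → ℂ, z = ∑ k ∈ Finset.range (n + 1), γ k • Φ k) :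
    ∃ β : ℕ → ℂ, y = Φ (n + 1) + ∑ k ∈ Finset.range (n + 1), β k • Φ k :=
  shell_of_step Φ h0 hsq hrec hcomm hT (hxy.trans (add_comm z y)) hx hz

end Engine

/-! ## §2 The shell ∕ top-coefficient theorem (h.1′) -/

section ULaws

variable {Kw : Type*} [Field Kw] [Valued Kw (WithZero (Multiplicative ℤ))] {σ : Kw →+* Kw} {ϖ' : Kw} [Finite (Valued.ResidueField Kw)]
  [IsHeckeTriple (⊤ : Submonoid (unitaryGroupOfForm σ ((StdForm.antidiagonal 3).over Kw))) (unitaryInt σ ((StdForm.antidiagonal 3).over Kw))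
    (unitaryInt σ ((StdForm.antidiagonal 3).over Kw))]

omit [Finite (Valued.ResidueField Kw)] in
/-- `Φ₀ = 1_{K₀ t⁰ K₀} = 1`. [cite: Macdonald1971, Ch. V §3] -/
private theorem doubleCosetOperator_torusGen_pow_zero (hd : UnramifiedLocalConjDatum σ ϖ') :
    heckeAlgebra.doubleCosetOperator (k := ℂ) (unitaryInt σ ((StdForm.antidiagonal 3).over Kw)) (hd.torusGen ^ 0) = 1 := by
  rw [pow_zero, heckeAlgebra.doubleCosetOperator_one]

/-- ★ W8-g square law with `Φ₁` written as `1_{K₀ t¹ K₀}`. [cite: Macdonald1971, Ch. V §3] -/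
private theorem doubleCosetOperator_torusGen_pow_one_mul_pow_one (hd : UnramifiedLocalConjDatum σ ϖ') (hσ : ∃ x : Kw, σ x ≠ x) :
    heckeAlgebra.doubleCosetOperator (k := ℂ) (unitaryInt σ ((StdForm.antidiagonal 3).over Kw)) (hd.torusGen ^ 1) *
        heckeAlgebra.doubleCosetOperator (unitaryInt σ ((StdForm.antidiagonal 3).over Kw)) (hd.torusGen ^ 1) =
      heckeAlgebra.doubleCosetOperator (unitaryInt σ ((StdForm.antidiagonal 3).over Kw)) (hd.torusGen ^ 2) +
        ((Nat.sqrt (Nat.card (Valued.ResidueField Kw)) - 1 : ℕ) : ℂ) •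
          heckeAlgebra.doubleCosetOperator (unitaryInt σ ((StdForm.antidiagonal 3).over Kw)) (hd.torusGen ^ 1) +
        ((Nat.card (Valued.ResidueField Kw) ^ 2 + Nat.sqrt (Nat.card (Valued.ResidueField Kw)) : ℕ) : ℂ) • 1 := by
  rw [pow_one]
  exact doubleCosetOperator_torusGen_mul_self hd hσ

/-- ★ W8-g three-term law with `Φ₁` written as `1_{K₀ t¹ K₀}`. [cite: Macdonald1971, Ch. V §3] -/
private theorem doubleCosetOperator_torusGen_pow_one_mul_pow (hd : UnramifiedLocalConjDatum σ ϖ') (hσ : ∃ x : Kw, σ x ≠ x) (m : ℕ) (hm : 2 ≤ m) :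
    heckeAlgebra.doubleCosetOperator (k := ℂ) (unitaryInt σ ((StdForm.antidiagonal 3).over Kw)) (hd.torusGen ^ 1) *
        heckeAlgebra.doubleCosetOperator (unitaryInt σ ((StdForm.antidiagonal 3).over Kw)) (hd.torusGen ^ m) =
      heckeAlgebra.doubleCosetOperator (unitaryInt σ ((StdForm.antidiagonal 3).over Kw)) (hd.torusGen ^ (m + 1)) +
        ((Nat.sqrt (Nat.card (Valued.ResidueField Kw)) - 1 : ℕ) : ℂ) •
          heckeAlgebra.doubleCosetOperator (unitaryInt σ ((StdForm.antidiagonal 3).over Kw)) (hd.torusGen ^ m) +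
        ((Nat.card (Valued.ResidueField Kw) ^ 2 : ℕ) : ℂ) •
          heckeAlgebra.doubleCosetOperator (unitaryInt σ ((StdForm.antidiagonal 3).over Kw)) (hd.torusGen ^ (m - 1)) := by
  rw [pow_one]
  exact doubleCosetOperator_torusGen_mul_pow hd hσ hm

omit [Finite (Valued.ResidueField Kw)] in
/-- ★ Gelfand: the Cartan powers commute with `Φ₁`. [cite: CartierCorvallis1979, §IV Thm. 4.1] -/
private theorem doubleCosetOperator_torusGen_pow_comm (hd : UnramifiedLocalConjDatum σ ϖ') (m : ℕ) :
    heckeAlgebra.doubleCosetOperator (k := ℂ) (unitaryInt σ ((StdForm.antidiagonal 3).over Kw)) (hd.torusGen ^ m) *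
        heckeAlgebra.doubleCosetOperator (unitaryInt σ ((StdForm.antidiagonal 3).over Kw)) (hd.torusGen ^ 1) =
      heckeAlgebra.doubleCosetOperator (unitaryInt σ ((StdForm.antidiagonal 3).over Kw)) (hd.torusGen ^ 1) *
        heckeAlgebra.doubleCosetOperator (unitaryInt σ ((StdForm.antidiagonal 3).over Kw)) (hd.torusGen ^ m) :=
  isGelfandPair_unitaryInt hd ℂ _ _

end ULaws

section Shell

variable {F E : Type} [Field F] [NumberField F] [Field E] [NumberField E] [Algebra F E] [Algebra.IsQuadraticExtension F E]
  (c : E ≃ₐ[F] E) (hc1 : c ≠ 1) (v : HeightOneSpectrum (𝓞 F)) (w : PlacesOver E v) (hw : c • w.1 = w.1)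
  (hv : Algebra.IsUnramifiedIn (𝓞 E) v.asIdeal)
  {K : Type u} [Field K] [ValuativeRel K] [IsDiscreteValuationRing 𝒪[K]] [Finite 𝓀[K]] {ϖ : K}
  [IsHeckeTriple (⊤ : Submonoid (GL (Fin 3) K)) (glInt 3 K) (glInt 3 K)]
  (hϖ : IsUniformizingElement ϖ) {u : ℂˣ} (hu : (u : ℂ) ^ 2 = ((Nat.card 𝓀[K] : ℕ) : ℂ))
  {wt : Multiplicative (Fin 3 → ℤ) →* ℂ}
  (hwt : ∀ e : Fin 3 → ℤ, wt (Multiplicative.ofAdd e) = ((u ^ ((((3 : ℕ) : ℤ) - 1) * (∑ i, e i) - 2 * satakeTwistExp e) : ℂˣ) : ℂ))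

/-- `(0,0,0)` as the cast vector of the pair `(0,0)`. [folklore] -/
private theorem vec_pair_zero : (![((0 : ℕ) : ℤ), ((0 : ℕ) : ℤ), 0] : Fin 3 → ℤ) = 0 := by
  funext i; fin_cases i <;> simp

/-- **★ (B.1′) AT `Φ₁ = 1_{K₀ t¹ K₀}`**: `bT₁ = Φ₁ + (Q − √Q + 1) • 1` (★ `bcGraphPartnerAlgHom_heckeDiag_one_eq_basic` + ★ `torusGen_eq_basic`).
[cite: Rogawski1990, §4.10 Prop. 4.10.2 p. 58] [cite: CartierCorvallis1979, §IV (4.2), Cor. 4.2] -/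
private theorem bcGraphPartnerAlgHom_heckeDiag_one_eq_torusGen_pow_one {ϖ' : w.1.adicCompletion E}
    (hd : UnramifiedLocalConjDatum (galAdicCompletionMap (L := E) c hw) ϖ')
    (hqQ : ((Nat.card 𝓀[K] : ℕ) : ℂ) = (Nat.card (Valued.ResidueField (w.1.adicCompletion E)) : ℂ)) :
    haveI := isHeckeTriple_unitaryInt_adicCompletion c v w hw ((StdForm.antidiagonal 3).over (w.1.adicCompletion E))
    bcGraphPartnerAlgHom c hc1 v w hw hv hϖ hu hwt
        (heckeAlgebra.doubleCosetOperator (glInt 3 K) (heckeDiag 3 (Units.mk0 ϖ hϖ.ne_zero) 1)) =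
      heckeAlgebra.doubleCosetOperator
          (unitaryInt (galAdicCompletionMap (L := E) c hw) ((StdForm.antidiagonal 3).over (w.1.adicCompletion E))) (hd.torusGen ^ 1) +
        ((Nat.card (Valued.ResidueField (w.1.adicCompletion E)) : ℂ) -
            (Nat.sqrt (Nat.card (Valued.ResidueField (w.1.adicCompletion E))) : ℂ) + 1) • 1 := by
  haveI := isHeckeTriple_unitaryInt_adicCompletion c v w hw ((StdForm.antidiagonal 3).over (w.1.adicCompletion E))
  -- (term-mode transport: `rw` on goals mixing the `GL₃` and `U(3)` carriers times out, cf. ★ W10-c)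
  have e := congrArg (fun g => heckeAlgebra.doubleCosetOperator (k := ℂ)
    (unitaryInt (galAdicCompletionMap (L := E) c hw) ((StdForm.antidiagonal 3).over (w.1.adicCompletion E))) g)
    ((pow_one hd.torusGen).trans (torusGen_eq_basic hd))
  exact (bcGraphPartnerAlgHom_heckeDiag_one_eq_basic c hc1 v w hw hv hϖ hu hwt hd hqQ).trans (congrArg (· + _) e.symm)

/-- **(h.1′) THE SHELL ∕ TOP-COEFFICIENT THEOREM FOR THE BASE-CHANGE PARTNER ON THE CARTAN BASIS.**  For `b ≤ a` there are coefficients `β_k ∈ ℂ`, `k < a`, with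
`b(c_{(a,b,0)}) = Φ_a + Σ_{k<a} β_k • Φ_k`, `Φ_m = 1_{K₀ tᵐ K₀}` the Cartan basis of `ℋ(U(3)_w, K₀)` (`t = diag(ϖ',1,ϖ'⁻¹)` of any unramified datum `hd` at `w`),
under the junction identity `hqQ : #𝓀[K] = #𝓀[E_w]` of ★ (B.1′): the image of the `GL₃` Cartan operator of shape `(a,b,0)` lies in the SHELL of radius `a` with
TOP COEFFICIENT ONE.  Induction on `a`: ★ (R1)∕(R2) (`GL₃` Pieri with leading count `1`, central collapse), `bT₁ = Φ₁ + (Q − √Q + 1)•1` ★ (B.1′),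
Macdonald's laws `Φ_kΦ₁ ∈ Φ_{k+1} + span{Φ_j : j ≤ k}` ★ W8-g and Gelfand commutativity ★ — assembled by the light-carrier engine of §1.
[cite: Rogawski1990, §4.10 Prop. 4.10.2 p. 58] [cite: Macdonald1995, Ch. V (2.5)–(2.6)] [cite: Macdonald1971, Ch. V §3] [cite: CartierCorvallis1979, §IV Thm. 4.1, Cor. 4.2] -/
theorem exists_bcGraphPartnerAlgHom_cartan_pair_eq_add_sum {ϖ' : w.1.adicCompletion E}
    (hd : UnramifiedLocalConjDatum (galAdicCompletionMap (L := E) c hw) ϖ')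
    (hqQ : ((Nat.card 𝓀[K] : ℕ) : ℂ) = (Nat.card (Valued.ResidueField (w.1.adicCompletion E)) : ℂ)) {a b : ℕ} (hba : b ≤ a) :
    haveI := isHeckeTriple_unitaryInt_adicCompletion c v w hw ((StdForm.antidiagonal 3).over (w.1.adicCompletion E))
    ∃ β : ℕ → ℂ,
      bcGraphPartnerAlgHom c hc1 v w hw hv hϖ hu hwt
          (heckeAlgebra.doubleCosetOperator (glInt 3 K) (zpowDiagGL hϖ.ne_zero ![(a : ℤ), (b : ℤ), 0])) =
        heckeAlgebra.doubleCosetOperator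
            (unitaryInt (galAdicCompletionMap (L := E) c hw) ((StdForm.antidiagonal 3).over (w.1.adicCompletion E))) (hd.torusGen ^ a) +
          ∑ k ∈ Finset.range a, β k •
            heckeAlgebra.doubleCosetOperator
              (unitaryInt (galAdicCompletionMap (L := E) c hw) ((StdForm.antidiagonal 3).over (w.1.adicCompletion E))) (hd.torusGen ^ k) := by
  haveI := isHeckeTriple_unitaryInt_adicCompletion c v w hw ((StdForm.antidiagonal 3).over (w.1.adicCompletion E))
  haveI := Literature.NumberTheory.Automorphic.finite_residueField_adicCompletion E w.1
  have hσ := exists_galAdicCompletionMap_ne c hc1 v w hw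
  -- the engine data on the `U(3)` side
  have h0 := doubleCosetOperator_torusGen_pow_zero (Kw := w.1.adicCompletion E) hd
  have hsq := doubleCosetOperator_torusGen_pow_one_mul_pow_one hd hσ
  have hrec := doubleCosetOperator_torusGen_pow_one_mul_pow hd hσ
  have hcomm := doubleCosetOperator_torusGen_pow_comm (Kw := w.1.adicCompletion E) hd
  have hT := bcGraphPartnerAlgHom_heckeDiag_one_eq_torusGen_pow_one c hc1 v w hw hv hϖ hu hwt hd hqQ
  -- strong induction on `a`, all `b ≤ a` at once
  suffices H : ∀ n b : ℕ, b ≤ n → ∃ β : ℕ → ℂ,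
      bcGraphPartnerAlgHom c hc1 v w hw hv hϖ hu hwt
          (heckeAlgebra.doubleCosetOperator (glInt 3 K) (zpowDiagGL hϖ.ne_zero ![(n : ℤ), (b : ℤ), 0])) =
        heckeAlgebra.doubleCosetOperator
            (unitaryInt (galAdicCompletionMap (L := E) c hw) ((StdForm.antidiagonal 3).over (w.1.adicCompletion E))) (hd.torusGen ^ n) +
          ∑ k ∈ Finset.range n, β k •
            heckeAlgebra.doubleCosetOperator
              (unitaryInt (galAdicCompletionMap (L := E) c hw) ((StdForm.antidiagonal 3).over (w.1.adicCompletion E))) (hd.torusGen ^ k) from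
    H a b hba
  intro n
  induction n using Nat.strong_induction_on with
  | _ n ih =>
  intro b hb
  rcases n with _ | n
  · -- `a = 0`: `B_{0,0} = b(c_0) = 1 = Φ₀` (★ (H.4.0))
    obtain rfl : b = 0 := Nat.le_zero.1 hb
    refine ⟨fun _ => 0, ?_⟩
    simp only [vec_pair_zero, bcGraphPartnerAlgHom_cartan_zero c hc1 v w hw hv hϖ hu hwt, Finset.sum_range_zero, add_zero, h0]
  · by_cases hbn : b ≤ n
    · -- (R1) at `(n, b)`
      have h := bcGraphPartnerAlgHom_cartan_pair_mul_heckeDiag_one c hc1 v w hw hv hϖ hu hwt hbn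
      have e1 : (n : ℤ) + 1 = ((n + 1 : ℕ) : ℤ) := by push_cast; ring
      have e2 : (b : ℤ) + 1 = ((b + 1 : ℕ) : ℤ) := by push_cast; ring
      simp only [e1, e2] at h
      refine shell_of_step₂ (fun m => heckeAlgebra.doubleCosetOperator (k := ℂ)
        (unitaryInt (galAdicCompletionMap (L := E) c hw) ((StdForm.antidiagonal 3).over (w.1.adicCompletion E))) (hd.torusGen ^ m))
        h0 hsq hrec hcomm hT h (ih n (Nat.lt_succ_self n) b hbn) (low_ite_smul _ _ fun hb1 => ?_) (low_ite_smul _ _ fun hb2 => ?_)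
      · exact low_of_shell _ (ih n (Nat.lt_succ_self n) (b + 1) hb1)
      · have e3 : (n : ℤ) - 1 = ((n - 1 : ℕ) : ℤ) := by omega
        have e4 : (b : ℤ) - 1 = ((b - 1 : ℕ) : ℤ) := by omega
        simp only [e3, e4]
        exact low_mono _ (by omega) (low_of_shell _ (ih (n - 1) (by omega) (b - 1) (by omega)))
    · -- (R2) at `n`: the diagonal `b = n + 1`
      have hb' : (b : ℤ) = (n : ℤ) + 1 := by omega
      have h := bcGraphPartnerAlgHom_cartan_diag_mul_heckeDiag_one c hc1 v w hw hv hϖ hu hwt n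
      have e1 : (n : ℤ) + 1 = ((n + 1 : ℕ) : ℤ) := by push_cast; ring
      simp only [e1] at h
      simp only [hb', e1]
      refine shell_of_step' (fun m => heckeAlgebra.doubleCosetOperator (k := ℂ)
        (unitaryInt (galAdicCompletionMap (L := E) c hw) ((StdForm.antidiagonal 3).over (w.1.adicCompletion E))) (hd.torusGen ^ m))
        h0 hsq hrec hcomm hT h (ih n (Nat.lt_succ_self n) n le_rfl) (low_ite_smul _ _ fun hn1 => ?_)
      have e3 : (n : ℤ) - 1 = ((n - 1 : ℕ) : ℤ) := by omega
      simp only [e3]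
      exact low_of_shell _ (ih n (Nat.lt_succ_self n) (n - 1) (Nat.sub_le n 1))

/-- `ν + (m+1)•𝟙 = (ν + m•𝟙) + 𝟙`. [folklore] -/
private theorem vec_add_succ_zsmul_one (ν : Fin 3 → ℤ) (m : ℤ) : ν + (m + 1) • (1 : Fin 3 → ℤ) = ν + m • 1 + 1 := by
  funext i; simp only [Pi.add_apply, Pi.smul_apply, Pi.one_apply, smul_eq_mul, mul_one]; ring

/-- `(ν + (m−1)•𝟙) + 𝟙 = ν + m•𝟙`. [folklore] -/
private theorem vec_add_pred_zsmul_one (ν : Fin 3 → ℤ) (m : ℤ) : ν + (m - 1) • (1 : Fin 3 → ℤ) + 1 = ν + m • 1 := by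
  funext i; simp only [Pi.add_apply, Pi.smul_apply, Pi.one_apply, smul_eq_mul, mul_one]; ring

/-- `ν + 0•𝟙 = ν`. [folklore] -/
private theorem vec_add_zero_zsmul_one (ν : Fin 3 → ℤ) : ν + (0 : ℤ) • (1 : Fin 3 → ℤ) = ν := by rw [zero_smul, add_zero]

/-- An antitone `ν` is `(ν₀−ν₂, ν₁−ν₂, 0) + ν₂•𝟙` with natural-number differences. [folklore] -/
private theorem vec_eq_pair_add_zsmul_one_of_antitone {ν : Fin 3 → ℤ} (hν : Antitone ν) :
    (![(((ν 0 - ν 2).toNat : ℕ) : ℤ), (((ν 1 - ν 2).toNat : ℕ) : ℤ), 0] : Fin 3 → ℤ) + (ν 2) • (1 : Fin 3 → ℤ) = ν := by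
  have h := antitone_fin_three_iff.1 hν
  funext i
  simp only [Pi.add_apply, Pi.smul_apply, Pi.one_apply, smul_eq_mul, mul_one]
  fin_cases i <;> simp <;> omega

/-- **CENTRAL COLLAPSE OVER `ℤ`**: `B_{ν + m•𝟙} = B_ν` for every `m ∈ ℤ` (★ (H.4.c) `bcGraphPartnerAlgHom_cartan_add_one` iterated both ways; `bT₃ = 1`).
[cite: Rogawski1990, §4.10 Prop. 4.10.2 p. 58] [cite: Macdonald1995, Ch. V (2.5)] -/
private theorem bcGraphPartnerAlgHom_cartan_add_zsmul_one (ν : Fin 3 → ℤ) (m : ℤ) :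
    bcGraphPartnerAlgHom c hc1 v w hw hv hϖ hu hwt (heckeAlgebra.doubleCosetOperator (glInt 3 K) (zpowDiagGL hϖ.ne_zero (ν + m • (1 : Fin 3 → ℤ)))) = bcGraphPartnerAlgHom c hc1 v w hw hv hϖ hu hwt (heckeAlgebra.doubleCosetOperator (glInt 3 K) (zpowDiagGL hϖ.ne_zero ν)) := by
  induction m using Int.induction_on with
  | zero => exact congrArg (fun ν' : Fin 3 → ℤ => bcGraphPartnerAlgHom c hc1 v w hw hv hϖ hu hwt (heckeAlgebra.doubleCosetOperator (glInt 3 K) (zpowDiagGL hϖ.ne_zero ν'))) (vec_add_zero_zsmul_one ν)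
  | succ m ih =>
    exact (congrArg (fun ν' : Fin 3 → ℤ => bcGraphPartnerAlgHom c hc1 v w hw hv hϖ hu hwt (heckeAlgebra.doubleCosetOperator (glInt 3 K) (zpowDiagGL hϖ.ne_zero ν'))) (vec_add_succ_zsmul_one ν m)).trans
      ((bcGraphPartnerAlgHom_cartan_add_one c hc1 v w hw hv hϖ hu hwt _).trans ih)
  | pred m ih =>
    exact (bcGraphPartnerAlgHom_cartan_add_one c hc1 v w hw hv hϖ hu hwt _).symm.trans
      ((congrArg (fun ν' : Fin 3 → ℤ => bcGraphPartnerAlgHom c hc1 v w hw hv hϖ hu hwt (heckeAlgebra.doubleCosetOperator (glInt 3 K) (zpowDiagGL hϖ.ne_zero ν'))) (vec_add_pred_zsmul_one ν (-(m : ℤ)))).trans ih)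

/-- **(h.1′) MOD CENTRE — THE SHELL THEOREM FOR AN ARBITRARY ANTITONE EXPONENT.**  For every antitone `ν : Fin 3 → ℤ` there are `β_k ∈ ℂ`, `k < ν₀ − ν₂`, with
`b(c_ν) = Φ_{ν₀−ν₂} + Σ_{k<ν₀−ν₂} β_k • Φ_k`: `B_ν` depends on `ν` only through `(ν₀−ν₂, ν₁−ν₂)` (central collapse ★ `bT₃ = 1`, over `ℤ`) and lands in the shell of
radius `ν₀ − ν₂` with top coefficient one (★ `exists_bcGraphPartnerAlgHom_cartan_pair_eq_add_sum`).  This is the form row E1.4.4.2.3 («`bφ_λ = Σ_m c_{λ,m} φ_m`»)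
consumes. [cite: Rogawski1990, §4.10 Prop. 4.10.2 p. 58] [cite: Macdonald1995, Ch. V (2.5)–(2.6)] [cite: Macdonald1971, Ch. V §3] -/
theorem exists_bcGraphPartnerAlgHom_cartan_eq_add_sum_of_antitone {ϖ' : w.1.adicCompletion E}
    (hd : UnramifiedLocalConjDatum (galAdicCompletionMap (L := E) c hw) ϖ')
    (hqQ : ((Nat.card 𝓀[K] : ℕ) : ℂ) = (Nat.card (Valued.ResidueField (w.1.adicCompletion E)) : ℂ)) {ν : Fin 3 → ℤ} (hν : Antitone ν) :
    haveI := isHeckeTriple_unitaryInt_adicCompletion c v w hw ((StdForm.antidiagonal 3).over (w.1.adicCompletion E))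
    ∃ β : ℕ → ℂ,
      bcGraphPartnerAlgHom c hc1 v w hw hv hϖ hu hwt (heckeAlgebra.doubleCosetOperator (glInt 3 K) (zpowDiagGL hϖ.ne_zero ν)) =
        heckeAlgebra.doubleCosetOperator (unitaryInt (galAdicCompletionMap (L := E) c hw) ((StdForm.antidiagonal 3).over (w.1.adicCompletion E))) (hd.torusGen ^ (ν 0 - ν 2).toNat) +
          ∑ k ∈ Finset.range (ν 0 - ν 2).toNat, β k • heckeAlgebra.doubleCosetOperator (unitaryInt (galAdicCompletionMap (L := E) c hw) ((StdForm.antidiagonal 3).over (w.1.adicCompletion E))) (hd.torusGen ^ k) := by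
  have hm := antitone_fin_three_iff.1 hν
  obtain ⟨β, hβ⟩ := exists_bcGraphPartnerAlgHom_cartan_pair_eq_add_sum c hc1 v w hw hv hϖ hu hwt hd hqQ
    (a := (ν 0 - ν 2).toNat) (b := (ν 1 - ν 2).toNat) (by omega)
  exact ⟨β, ((congrArg (fun ν' : Fin 3 → ℤ => bcGraphPartnerAlgHom c hc1 v w hw hv hϖ hu hwt (heckeAlgebra.doubleCosetOperator (glInt 3 K) (zpowDiagGL hϖ.ne_zero ν'))) (vec_eq_pair_add_zsmul_one_of_antitone hν)).symm.trans
    (bcGraphPartnerAlgHom_cartan_add_zsmul_one c hc1 v w hw hv hϖ hu hwt _ _)).trans hβ⟩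

end Shell

end Summit.HodgeConjecture.HodgeConjecture.R90.S6

end
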